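import Summits.NavierStokesRegularity.FluidComputer.GateBudgetRungSucc
import HarnessLib

/-!
# What no tuning can beat, part 64: THE MISFIRE LADDER — the headline member misfires `N` times
# in a row for every `N` inside two linear budgets (`N` up to `≍ 3·10⁻⁵K⁸` for lattice index
# `k ≲ K²`), and its output gate stays below `0.1415` until time `≥ N + 1.8` (step (20′d′) of
# SPEC-INPUT-bp1 §AW/§AZ/§BC: the iteration of part 63's rung map)

Cell `pub-fluidc`, blueprint seat bp1 (gen 35, seventh item); same namespace and conventions as
parts 1–63 (`GateBudget*.lean`); imports part 63 (`GateBudgetRungSucc`: §196 `rung_numerics`,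
§197 `knob_rung_succ`; through it part 49 `GateBudgetSharpPin`: §145
`knob_dud_second_pin_sharp`, the first re-ignition, and the knob toolkit `RotorKnob.e_nonneg`,
`RotorKnob.rotorCircuit_output_monotone`). Headline knob family `rotorCircuit K K¹⁰ ε ρ` from
(5.6) (`σ = ρ²e^{-K¹⁰}`, `μ = ε⁻¹K¹⁰`; modes `0 = a` carrier, `1 = b` clock, `2 = c` trigger,
`3 = d`, `4 = ã` output). HONEST FRAMING (verbatim): low prior, high value-of-information
experiment on Tao's machine paradigm; NOT a claim that NS blows up. Nothing is proved about the
Navier–Stokes equations.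

## Why (SPEC-INPUT-bp1 §AW "∀ n ≤ N(k, K) the n-th pulse misfires", §BC(3)(B))

Part 63 typed ONE rung of the dud: an ignition in normal form `(r, θ, P)` — `b(r) = θε`,
`5/4 ≤ θ ≤ 1.45`, `c(r) = ρ²/K⁹`, `P = d(r)² + ã(r)²` with `P + s ≤ 1/50`,
`s = 0.3η + 6/K⁹` — is followed by a misfiring pulse and a re-ignition `(r', θ', P')` with
`r' ≥ r + 1`, `θ' ≤ 1.41422`, `θ' ≥ θ - 286/K⁹ ∨ θ' ≥ 1.39999`, `P' ≤ P + s`. The ladder is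
its iteration under two LINEAR budgets: the clock window (start `θ₁ ≥ 1.394 = 5/4 + 0.144` at the
first re-ignition of part 49 §145, lose `≤ 286/K⁹` per rung or be reset above `1.39999`:
`(N - 1)·286/K⁹ ≤ 0.144`) and the pair ledger (start `P₁ ≤ 0.00806`, gain `≤ s` per rung:
`0.00806 + N·s ≤ 1/50`). The induction invariant at rung `n ≤ N` is
`5/4 + (N - n)·286/K⁹ ≤ θₙ ≤ 29/20`, `Pₙ ≤ P₁ + (n - 1)s`, `rₙ ≥ r₁ + (n - 1)`. Since the
output `ã` is non-decreasing and `ã(r_N)² ≤ P_N ≤ 1/50`, the machine's output stays below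
`0.1415` on `[0, N + 1.8282]` — it never fires while the ladder lasts (a firing comb drives
`ã → 1`, part 1 / GateBudgetCombInstant).

## What is proved

* §198 `knob_ladder_climb` (generic induction): from ANY ignition `(r₀, θ₀, P₁)` in normal form
  with `5/4 + (N - 1)·286/K⁹ ≤ θ₀ ≤ 29/20`, `(N - 1)·286/K⁹ ≤ 0.14999`, `P₁ + N·s ≤ 1/50`:
  for every `1 ≤ n ≤ N` an `n`-th ignition `rₙ ≥ r₀ + (n - 1)` in normal form with the
  invariant above.
* §199 `knob_ladder_anchor`: the first re-ignition `r₁ > 2.8282` of part 49 §145 is in normal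
  form with `1.394 ≤ θ₁ ≤ 1.44` and `P(r₁) ≤ 0.00806` (`ã(r₁) ≤ ã(T₂)`, `P(T₂) ≤ 3/400`,
  `d(r₁)² ≤ 1/(7K²) + 6/K⁹`).
* §200 `knob_misfire_ladder` (THE LADDER): headline member from `delayInit` with a trigger
  primitive, `K ≥ 16`, `0 < ε`, `ε² ≤ 1/(6K²⁰)`, `0 < ρ`, `200ε/K²⁰ ≤ ρ² ≤ 2ε/K¹⁰`,
  `ε = kK¹⁰ρ²`; any `N : ℕ` with `(N - 1)·286/K⁹ ≤ 0.144` and `0.00806 + N·s ≤ 1/50`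
  (`s = 0.3(δ₀ + 1210/K⁸) + 6/K⁹`, `δ₀ = kπ/((25/16 - 10⁻⁶)K¹⁰ - 1) + 1/K¹⁹`) ⇒ for every
  `1 ≤ n ≤ N` there is an `n`-th ignition `rₙ > 1.8282 + n` in normal form (`5/4 ≤ θₙ ≤ 29/20`,
  `Pₙ + s ≤ 1/50`) whose pulse MISFIRES: `rₙ < T'ₙ ≤ rₙ + 242/K⁹`, exit clock
  `b(T'ₙ) = -θ'ε` with `θ' ≥ 5/4 - 10⁻⁸`, dousing `c(T'ₙ) ≤ 2ρ²/K¹⁰`, lattice pin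
  `|(C(T'ₙ) - C(rₙ))/ρ² - kπ| ≤ δ₀`, output growth `ã(T'ₙ) ≤ ã(rₙ) + 242/K⁸`.
* §201 `knob_ladder_no_output`: under the same hypotheses with `1 ≤ N`, `ã(t) ≤ 0.1415` for all
  `0 ≤ t ≤ N + 1.8282`.

HONEST LIMITS. (i) The binding budget is the pair ledger: `s = 0.3δ₀ + 363/K⁸ + 6/K⁹` with
`δ₀ ≈ 2.01k/K¹⁰`, so `N ≤ 0.01194/s`: `≍ 3.3·10⁻⁵K⁸` rungs for `k ≲ K²` (`≈ 1.4·10⁵` at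
`K = 16`, a factor `≈ 3` short of SPEC §AW's heuristic `10⁻⁴K⁸`), but only `≈ 4` rungs at the
top of the lattice window `k ≍ K¹⁰/200` (`δ₀ ≈ 0.01`); the clock window alone would allow
`5·10⁻⁴K⁹`. A relative pair law (successor of part 52 §154's absolute `968/K⁸ + 242/K⁸` and of
its `kπ/(ν₂K¹⁰)` pin slip) would lift it (SPEC §BC(4)). (ii) `P₁ ≤ 0.00806` is part 49's
coarse `P(T₂) ≤ 3/400`; part 51's `P ≤ 1/600` is not used because its instance is a separate
existential. (iii) Headline family `M = K¹⁰`, `K ≥ 16`, lattice `ε = kK¹⁰ρ²` only. (iv) What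
happens AFTER rung `N` (the window or the ledger exhausted) is not claimed. (v) Nothing about
Navier–Stokes.
[cite: Tao2016AveragedNS, §5.5 Theorem 5.3, (5.5), (5.6), (b-eq), (c-eq), (ta-eq), (energy-con)]
-/

noncomputable section

namespace Summit.NavierStokesRegularity.FluidComputer.GateBudget

open Real Set
open Literature.Analysis.FluidPDE.Tao2016AveragedNS

variable {K ε ρ : ℝ} {X : ℝ → Fin 5 → ℝ}

/-! ## §198 The generic climb -/

/-- §198 THE GENERIC CLIMB (induction on the rung index with part 63's rung map). Headline
member with a trigger primitive on the lattice window; an ignition `r₀ ≥ 0` in normal form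
`b(r₀) = θ₀ε`, `c(r₀) = ρ²/K⁹`, `P(r₀) ≤ P₁`, with `5/4 + (N - 1)·286/K⁹ ≤ θ₀ ≤ 29/20`,
`(N - 1)·286/K⁹ ≤ 0.14999` and `P₁ + N·s ≤ 1/50` ⇒ for every `1 ≤ n ≤ N` an ignition
`rₙ ≥ r₀ + (n - 1)` with `b(rₙ) = θₙε`, `5/4 + (N - n)·286/K⁹ ≤ θₙ ≤ 29/20`, `c(rₙ) = ρ²/K⁹`,
`P(rₙ) ≤ P₁ + (n - 1)s`. [derived: part 63 §197, `Nat.le_induction`] -/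
theorem knob_ladder_climb
    (hX : ∀ t, HasDerivAt X (RotorKnob.rotorCircuit K (K ^ 10) ε ρ (X t)) t)
    (h0 : X 0 = delayInit) {C : ℝ → ℝ} (hC : ∀ t, HasDerivAt C (X t 2) t) (hK : 16 ≤ K)
    (hε : 0 < ε) (hεK : ε ^ 2 ≤ 1 / (6 * K ^ 20)) (hρ : 0 < ρ)
    (hlo : 200 * ε / K ^ 20 ≤ ρ ^ 2) (hhi : K ^ 10 * ρ ^ 2 ≤ 2 * ε) (k : ℕ)
    (hk : ε = k * K ^ 10 * ρ ^ 2) {r₀ θ₀ P₁ : ℝ} {N : ℕ} (hr₀ : 0 ≤ r₀)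
    (hb₀ : X r₀ 1 = θ₀ * ε) (hc₀ : X r₀ 2 = ρ ^ 2 / K ^ 9) (hP₁ : X r₀ 3 ^ 2 + X r₀ 4 ^ 2 ≤ P₁)
    (hθ₀lo : 5 / 4 + ((N : ℝ) - 1) * (286 / K ^ 9) ≤ θ₀) (hθ₀hi : θ₀ ≤ 29 / 20)
    (hNθ : ((N : ℝ) - 1) * (286 / K ^ 9) ≤ 14999 / 100000)
    (hNP : P₁ + (N : ℝ) * (3 * (k * π / ((25 / 16 - 1 / 10 ^ 6) * K ^ 10 - 1) + 1 / K ^ 19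
      + 1210 / K ^ 8) / 10 + 6 / K ^ 9) ≤ 1 / 50) :
    ∀ n : ℕ, 1 ≤ n → n ≤ N → ∃ r θ : ℝ, r₀ + ((n : ℝ) - 1) ≤ r ∧ X r 1 = θ * ε ∧
      5 / 4 + ((N : ℝ) - n) * (286 / K ^ 9) ≤ θ ∧ θ ≤ 29 / 20 ∧ X r 2 = ρ ^ 2 / K ^ 9 ∧
      X r 3 ^ 2 + X r 4 ^ 2 ≤ P₁ + ((n : ℝ) - 1) * (3 * (k * π / ((25 / 16 - 1 / 10 ^ 6)
        * K ^ 10 - 1) + 1 / K ^ 19 + 1210 / K ^ 8) / 10 + 6 / K ^ 9) := by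
  obtain ⟨-, -, -, hδ0, -, -⟩ := rung_numerics hK hε hρ hlo k hk
  have hK0 : (0 : ℝ) < K := by linarith
  have h286 : (0 : ℝ) ≤ 286 / K ^ 9 := by positivity
  have h1210 : (0 : ℝ) ≤ 1210 / K ^ 8 := by positivity
  have h6 : (0 : ℝ) ≤ 6 / K ^ 9 := by positivity
  obtain ⟨s, hs_def⟩ : ∃ s : ℝ, s = 3 * (k * π / ((25 / 16 - 1 / 10 ^ 6) * K ^ 10 - 1)
      + 1 / K ^ 19 + 1210 / K ^ 8) / 10 + 6 / K ^ 9 := ⟨_, rfl⟩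
  have hs0 : 0 ≤ s := by rw [hs_def]; linarith only [hδ0, h1210, h6]
  simp only [← hs_def] at hNP ⊢
  intro n hn
  induction n, hn using Nat.le_induction with
  | base =>
    intro _
    exact ⟨r₀, θ₀, by simp, hb₀, by simpa using hθ₀lo, hθ₀hi, hc₀, by simpa using hP₁⟩
  | succ m hm ih =>
    intro hmN
    obtain ⟨r, θ, hr, hb, hθlo, hθhi, hc, hP⟩ := ih (Nat.le_of_succ_le hmN)
    have hm1 : (1 : ℝ) ≤ m := by exact_mod_cast hm
    have hmN' : (m : ℝ) + 1 ≤ N := by exact_mod_cast hmN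
    have hNm : 0 ≤ ((N : ℝ) - m) * (286 / K ^ 9) := mul_nonneg (by linarith) h286
    have hmq : 0 ≤ (m : ℝ) * (286 / K ^ 9) := mul_nonneg (by linarith) h286
    have hr0 : 0 ≤ r := by linarith only [hr₀, hr, hm1]
    have hθ1 : 5 / 4 ≤ θ := by linarith only [hθlo, hNm]
    have hms : ((m : ℝ) - 1) * s + s ≤ N * s := by nlinarith only [hs0, hmN']
    have key : X r 3 ^ 2 + X r 4 ^ 2 + s ≤ 1 / 50 := by linarith only [hP, hNP, hms]
    have hPr : X r 3 ^ 2 + X r 4 ^ 2 + 3 * (k * π / ((25 / 16 - 1 / 10 ^ 6) * K ^ 10 - 1)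
        + 1 / K ^ 19 + 1210 / K ^ 8) / 10 + 6 / K ^ 9 ≤ 1 / 50 := by
      rw [hs_def] at key; linarith only [key]
    obtain ⟨T', θ₁, tz, r', θ', -, ⟨-, -, -, -, -, hc'⟩, hb', hθ'hi, hθ'lo, hP', hrr'⟩ :=
      knob_rung_succ hX h0 hC hK hε hεK hρ hlo hhi k hk hr0 hθ1 hθhi hb hc hPr
    have hP's : X r' 3 ^ 2 + X r' 4 ^ 2 ≤ X r 3 ^ 2 + X r 4 ^ 2 + s := by
      rw [hs_def]; linarith only [hP']
    refine ⟨r', θ', ?_, hb', ?_, by linarith only [hθ'hi], ?_, ?_⟩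
    · push_cast; linarith only [hr, hrr']
    · push_cast
      rcases hθ'lo with h | h
      · linarith only [hθlo, h]
      · linarith only [hNθ, h, hmq]
    · exact hc'
    · push_cast; linarith only [hP, hP's]

/-! ## §199 The anchor: the first re-ignition of part 49 -/

/-- §199 THE ANCHOR of the ladder: the first re-ignition `r₁` of part 49 §145 is in normal form —
`r₁ > 2.8282`, `b(r₁) = θ₁ε` with `1.394 ≤ θ₁ ≤ 1.44`, `c(r₁) = ρ²/K⁹` — and its pair energy
is small, `P(r₁) = d(r₁)² + ã(r₁)² ≤ 0.00806` (`d(r₁)² ≤ 1/(7K²) + 6/K⁹` from §145, and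
`0 ≤ ã(r₁) ≤ ã(T₂)` by monotonicity of the output with `ã(T₂)² ≤ P(T₂) ≤ 3/400`).
[derived: part 49 §145 + RotorKnob.e_nonneg / rotorCircuit_output_monotone] -/
theorem knob_ladder_anchor
    (hX : ∀ t, HasDerivAt X (RotorKnob.rotorCircuit K (K ^ 10) ε ρ (X t)) t)
    (h0 : X 0 = delayInit) {C : ℝ → ℝ} (hC : ∀ t, HasDerivAt C (X t 2) t) (hK : 16 ≤ K)
    (hε : 0 < ε) (hεK : ε ^ 2 ≤ 1 / (6 * K ^ 20)) (hρ : 0 < ρ)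
    (hlo : 200 * ε / K ^ 20 ≤ ρ ^ 2) (hhi : K ^ 10 * ρ ^ 2 ≤ 2 * ε) (k : ℕ)
    (hk : ε = k * K ^ 10 * ρ ^ 2) :
    ∃ r₁ θ₁ : ℝ, 28282 / 10000 < r₁ ∧ X r₁ 1 = θ₁ * ε ∧ 1394 / 1000 ≤ θ₁ ∧ θ₁ ≤ 144 / 100 ∧
      X r₁ 2 = ρ ^ 2 / K ^ 9 ∧ X r₁ 3 ^ 2 + X r₁ 4 ^ 2 ≤ 806 / 100000 := by
  obtain ⟨T, tz, r₁, T₂, ⟨hr1lo, -, hr1T2, -, -, -, -, hcr1, -, -, -, -⟩,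
      ⟨-, -, -, -, -, -, -, -, -, -, hd1⟩, ⟨hblo, hbhi, -, -, -, -⟩, -, -, -, -, -, -, hPT2,
      -, -⟩ :=
    knob_dud_second_pin_sharp hX h0 hC hK hε hεK hρ hlo hhi k hk
  have hK0 : (0 : ℝ) < K := by linarith
  have hr1 : 28282 / 10000 < r₁ := by
    have := Real.sqrt_nonneg (2 - 24 * Real.log K / K ^ 10)
    linarith only [this, hr1lo]
  have hmono := RotorKnob.rotorCircuit_output_monotone hK0.le hX
  have he1 : X r₁ 4 ≤ X T₂ 4 := hmono hr1T2.le
  have he0 : 0 ≤ X r₁ 4 := RotorKnob.e_nonneg hX h0 hK0.le (by linarith only [hr1])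
  have he2 : X r₁ 4 ^ 2 ≤ X T₂ 4 ^ 2 := pow_le_pow_left₀ he0 he1 2
  have hK2 : (256 : ℝ) ≤ K ^ 2 := by nlinarith only [hK]
  have hK9 : (2 : ℝ) ^ 36 ≤ K ^ 9 := by
    calc (2 : ℝ) ^ 36 = 16 ^ 9 := by norm_num
      _ ≤ K ^ 9 := pow_le_pow_left₀ (by norm_num) hK 9
  have hd1' : 1 / (7 * K ^ 2) ≤ 1 / 1792 :=
    div_le_div_of_nonneg_left (by norm_num) (by norm_num) (by linarith only [hK2])
  have h6 : 6 / K ^ 9 ≤ 6 / 2 ^ 36 := div_le_div_of_nonneg_left (by norm_num) (by positivity) hK9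
  have h6' : (6 : ℝ) / 2 ^ 36 ≤ 1 / 10 ^ 9 := by norm_num
  refine ⟨r₁, X r₁ 1 / ε, hr1, ?_, ?_, ?_, hcr1, ?_⟩
  · field_simp
  · rw [le_div_iff₀ hε]; linarith only [hblo]
  · rw [div_le_iff₀ hε]; linarith only [hbhi]
  · linarith only [hd1, hd1', h6, h6', he2, hPT2, sq_nonneg (X T₂ 3)]

/-! ## §200 The misfire ladder -/

/-- §200 THE MISFIRE LADDER (20′d′) (SPEC-INPUT-bp1 §AW/§AZ(7)/§BC(3)). Headline member from
`delayInit` with a trigger primitive `C`, `K ≥ 16`, `0 < ε`, `ε² ≤ 1/(6K²⁰)`, `0 < ρ`, lattice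
window `200ε/K²⁰ ≤ ρ²`, `K¹⁰ρ² ≤ 2ε`, `ε = kK¹⁰ρ²`; any `N : ℕ` inside both budgets,
`(N - 1)·286/K⁹ ≤ 0.144` (clock window) and `0.00806 + N·s ≤ 1/50`,
`s = 0.3(δ₀ + 1210/K⁸) + 6/K⁹` (pair ledger). Then for every `1 ≤ n ≤ N` there is an `n`-th
ignition `rₙ > 1.8282 + n` in normal form (`b(rₙ) = θₙε`, `5/4 ≤ θₙ ≤ 29/20`,
`c(rₙ) = ρ²/K⁹`, `P(rₙ) + s ≤ 1/50`) whose pulse MISFIRES: there are `T' θ'` with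
`rₙ < T' ≤ rₙ + 242/K⁹`, `b(T') = -θ'ε`, `θ' ≥ 5/4 - 10⁻⁸`, `c(T') ≤ 2ρ²/K¹⁰`,
`|(C(T') - C(rₙ))/ρ² - kπ| ≤ δ₀` and `ã(T') ≤ ã(rₙ) + 242/K⁸`.
[derived: this file §198/§199 + part 63 §197; Tao2016AveragedNS (5.6)] -/
theorem knob_misfire_ladder
    (hX : ∀ t, HasDerivAt X (RotorKnob.rotorCircuit K (K ^ 10) ε ρ (X t)) t)
    (h0 : X 0 = delayInit) {C : ℝ → ℝ} (hC : ∀ t, HasDerivAt C (X t 2) t) (hK : 16 ≤ K)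
    (hε : 0 < ε) (hεK : ε ^ 2 ≤ 1 / (6 * K ^ 20)) (hρ : 0 < ρ)
    (hlo : 200 * ε / K ^ 20 ≤ ρ ^ 2) (hhi : K ^ 10 * ρ ^ 2 ≤ 2 * ε) (k : ℕ)
    (hk : ε = k * K ^ 10 * ρ ^ 2) (N : ℕ)
    (hNθ : ((N : ℝ) - 1) * (286 / K ^ 9) ≤ 144 / 1000)
    (hNP : 806 / 100000 + (N : ℝ) * (3 * (k * π / ((25 / 16 - 1 / 10 ^ 6) * K ^ 10 - 1)
      + 1 / K ^ 19 + 1210 / K ^ 8) / 10 + 6 / K ^ 9) ≤ 1 / 50) :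
    ∀ n : ℕ, 1 ≤ n → n ≤ N → ∃ r θ T' θ' : ℝ,
      (18282 / 10000 + n < r ∧ X r 1 = θ * ε ∧ 5 / 4 ≤ θ ∧ θ ≤ 29 / 20 ∧
        X r 2 = ρ ^ 2 / K ^ 9 ∧
        X r 3 ^ 2 + X r 4 ^ 2 + (3 * (k * π / ((25 / 16 - 1 / 10 ^ 6) * K ^ 10 - 1)
          + 1 / K ^ 19 + 1210 / K ^ 8) / 10 + 6 / K ^ 9) ≤ 1 / 50) ∧
      (r < T' ∧ T' - r ≤ 242 / K ^ 9 ∧ X T' 1 = -(θ' * ε) ∧ 5 / 4 - 1 / 10 ^ 8 ≤ θ' ∧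
        X T' 2 ≤ 2 * ρ ^ 2 / K ^ 10 ∧
        |(C T' - C r) / ρ ^ 2 - k * π|
          ≤ k * π / ((25 / 16 - 1 / 10 ^ 6) * K ^ 10 - 1) + 1 / K ^ 19 ∧
        X T' 4 ≤ X r 4 + 242 / K ^ 8) := by
  obtain ⟨-, -, -, hδ0, -, h243⟩ := rung_numerics hK hε hρ hlo k hk
  have hK0 : (0 : ℝ) < K := by linarith
  have h286 : (0 : ℝ) ≤ 286 / K ^ 9 := by positivity
  have h1210 : (0 : ℝ) ≤ 1210 / K ^ 8 := by positivity
  have h6 : (0 : ℝ) ≤ 6 / K ^ 9 := by positivity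
  obtain ⟨r₁, θ₁, hr1, hb1, hθ1lo, hθ1hi, hc1, hP1⟩ :=
    knob_ladder_anchor hX h0 hC hK hε hεK hρ hlo hhi k hk
  have hclimb := knob_ladder_climb hX h0 hC hK hε hεK hρ hlo hhi k hk (N := N)
    (by linarith only [hr1]) hb1 hc1 hP1 (by linarith only [hNθ, hθ1lo])
    (by linarith only [hθ1hi]) (by linarith only [hNθ]) hNP
  obtain ⟨s, hs_def⟩ : ∃ s : ℝ, s = 3 * (k * π / ((25 / 16 - 1 / 10 ^ 6) * K ^ 10 - 1)
      + 1 / K ^ 19 + 1210 / K ^ 8) / 10 + 6 / K ^ 9 := ⟨_, rfl⟩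
  have hs0 : 0 ≤ s := by rw [hs_def]; linarith only [hδ0, h1210, h6]
  simp only [← hs_def] at hNP hclimb ⊢
  intro n hn hnN
  obtain ⟨r, θ, hr, hb, hθlo, hθhi, hc, hP⟩ := hclimb n hn hnN
  have hn1 : (1 : ℝ) ≤ n := by exact_mod_cast hn
  have hnN' : (n : ℝ) ≤ N := by exact_mod_cast hnN
  have hNn : 0 ≤ ((N : ℝ) - n) * (286 / K ^ 9) := mul_nonneg (by linarith) h286
  have hθ1 : 5 / 4 ≤ θ := by linarith only [hθlo, hNn]
  have hr0 : 0 ≤ r := by linarith only [hr, hr1, hn1]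
  have hns : ((n : ℝ) - 1) * s + s ≤ N * s := by nlinarith only [hs0, hnN']
  have key : X r 3 ^ 2 + X r 4 ^ 2 + s ≤ 1 / 50 := by linarith only [hP, hNP, hns]
  have hPr : X r 3 ^ 2 + X r 4 ^ 2 + 3 * (k * π / ((25 / 16 - 1 / 10 ^ 6) * K ^ 10 - 1)
      + 1 / K ^ 19 + 1210 / K ^ 8) / 10 + 6 / K ^ 9 ≤ 1 / 50 := by
    rw [hs_def] at key; linarith only [key]
  obtain ⟨T', θ', tz, r', θn, ⟨hrT, hτ, -, hbT, hθ'lo, -, hcT, hpin, -, hã⟩, -, -⟩ :=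
    knob_rung_succ hX h0 hC hK hε hεK hρ hlo hhi k hk hr0 hθ1 hθhi hb hc hPr
  exact ⟨r, θ, T', θ', ⟨by linarith only [hr, hr1], hb, hθ1, hθhi, hc, key⟩,
    ⟨hrT, hτ, hbT, by linarith only [hθ'lo, hθ1, h243], hcT, hpin, hã⟩⟩

/-! ## §201 No output while the ladder lasts -/

/-- §201 NO OUTPUT WHILE THE LADDER LASTS: under the hypotheses of §200 with `1 ≤ N`, the output
gate satisfies `ã(t) ≤ 0.1415` for every `0 ≤ t ≤ N + 1.8282` (`ã` is non-decreasing and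
`ã(r_N)² ≤ P(r_N) ≤ 1/50` at the `N`-th ignition `r_N > N + 1.8282`). A firing machine has
`ã → 1`; the misfiring one is stuck below `1/7` for a time `≍ N`.
[derived: this file §200 + RotorKnob.e_nonneg / rotorCircuit_output_monotone] -/
theorem knob_ladder_no_output
    (hX : ∀ t, HasDerivAt X (RotorKnob.rotorCircuit K (K ^ 10) ε ρ (X t)) t)
    (h0 : X 0 = delayInit) {C : ℝ → ℝ} (hC : ∀ t, HasDerivAt C (X t 2) t) (hK : 16 ≤ K)
    (hε : 0 < ε) (hεK : ε ^ 2 ≤ 1 / (6 * K ^ 20)) (hρ : 0 < ρ)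
    (hlo : 200 * ε / K ^ 20 ≤ ρ ^ 2) (hhi : K ^ 10 * ρ ^ 2 ≤ 2 * ε) (k : ℕ)
    (hk : ε = k * K ^ 10 * ρ ^ 2) (N : ℕ) (hN : 1 ≤ N)
    (hNθ : ((N : ℝ) - 1) * (286 / K ^ 9) ≤ 144 / 1000)
    (hNP : 806 / 100000 + (N : ℝ) * (3 * (k * π / ((25 / 16 - 1 / 10 ^ 6) * K ^ 10 - 1)
      + 1 / K ^ 19 + 1210 / K ^ 8) / 10 + 6 / K ^ 9) ≤ 1 / 50) :
    ∀ t ∈ Icc (0 : ℝ) (18282 / 10000 + N), X t 4 ≤ 1415 / 10000 := by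
  obtain ⟨-, -, -, hδ0, -, -⟩ := rung_numerics hK hε hρ hlo k hk
  have hK0 : (0 : ℝ) < K := by linarith
  have h1210 : (0 : ℝ) ≤ 1210 / K ^ 8 := by positivity
  have h6 : (0 : ℝ) ≤ 6 / K ^ 9 := by positivity
  obtain ⟨r, θ, T', θ', ⟨hr, -, -, -, -, hP⟩, -⟩ :=
    knob_misfire_ladder hX h0 hC hK hε hεK hρ hlo hhi k hk N hNθ hNP N hN le_rfl
  intro t ht
  have hmono := RotorKnob.rotorCircuit_output_monotone hK0.le hX
  have h1 : X t 4 ≤ X r 4 := hmono (by linarith only [ht.2, hr])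
  have hsq : X r 4 ^ 2 ≤ (1415 / 10000) ^ 2 := by
    nlinarith only [hP, sq_nonneg (X r 3), hδ0, h1210, h6]
  exact h1.trans (abs_le_of_sq_le_sq' hsq (by norm_num)).2

end Summit.NavierStokesRegularity.FluidComputer.GateBudget

end
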